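import Summits.BirchSwinnertonDyer.BirchSwinnertonDyer.Theorems.SignedLowerHalvesSmallImageLowerHalfBothSignsRttCharRoadE1LocalAtPGlue
import Summits.BirchSwinnertonDyer.BirchSwinnertonDyer.Theorems.SignedLowerHalvesSmallImageLowerHalfBothSignsRttCharRoadE1AwayCores
import Summits.BirchSwinnertonDyer.BirchSwinnertonDyer.Theorems.SignedLowerHalvesSmallImageLowerHalfBothSignsRttCharRoadE1AwayGlue
import Summits.BirchSwinnertonDyer.BirchSwinnertonDyer.Theorems.SignedLowerHalvesSmallImageLowerHalfBothSignsRttCharRoadE1InertiaRange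
import Summits.BirchSwinnertonDyer.BirchSwinnertonDyer.Theorems.SignedLowerHalvesSmallImageLowerHalfBothSignsRttCharRoadE1TopPackagingCond
import Summits.BirchSwinnertonDyer.BirchSwinnertonDyer.Theorems.SignedLowerHalvesSmallImageLowerHalfBothSignsRttCharRoadE1TowerLayers
import Literature.NumberTheory.EllipticCurves.SelmerCorankControlRatProofs
import Literature.NumberTheory.Automorphic.ReciprocityGLnCor93Proofs
import HarnessLib

/-!
# Route `SignedLowerHalves`, crux L `SmallImageLowerHalfBothSigns` (stmt-BirchSwinnertonDyer-23599), line `rtt_w3` v12 — glue block DESC, COMPOSITE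
# (`Lines/rtt_w3-GLUE-g7.md` §4–§5): ONE theorem taking a `K`-side layer-`n` class `y ∈ H¹(Γ_{K_n}, W_K[p^∞])` that is (i) in Kobayashi's signed Kummer
# condition `E^ε(K_n·K_w)` at `closureEmb K_w`, (ii) unramified outside `S₀K ∪ {p}` (all `Γ_K`-conjugates) and (iii) killed by `p`, to the element
# `res_{ℚ_∞} cor (e^* subgroupH1Iso (res_= y))` of the INJ_top target `{x : AcSigned.selmer W p κ ↑S₀ (fun _ ↦ .sgn ε) | p • x = 0}` — assembling
# -w3 g17's ★★★★★ `resOfLe_corH1_mem_condAbove_sgn` (p767713, at `p`) and ★★ `corH1_resH1Hom_mem_unramifiedOutside` (p767858, away from `p`) with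
# -w3 g18's `corH1_subgroupH1Iso_mem_unramifiedOutside` (p768350, which contains the `subgroupH1Iso` transport (d1)), `inertia_le_galRange_of_not_mem` ((d2) p768106) and
# `resOfLe_mem_acSignedSelmer_of_layer_of_condAbove` (p767739).

LEAD `cruxlead-stmt-BirchSwinnertonDyer-23599` g7's draft (HOME `g7-sources/RttCharRoadE1DescComposite.lean`), repaired after the (d1) name collision and landed by the width
seat `bsd-line-slh-p3-w3` g18 (cell `bsd-ssimc`; `--supports stmt-BirchSwinnertonDyer-23599 --as helper`): the «away from `p`» input is -w3 g18's ★★★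
`corH1_subgroupH1Iso_mem_unramifiedOutside` (p768350). THEOREMS ONLY (no definition, no named fact, no instance, no `sorry`). BSD / crux L / INJ_top are NOT proved here: the composition `charRoad_injTop` still needs block T (J-loc′ + twist compatibility +
§2(c)); this file is the whole W-side half.

WHAT: ★★★ `desc_resOfLe_corH1_mem_acSignedSelmer` (membership; the place of `ℚ` above `p` is unique, tree `heightOneSpectrum_rat_eq_of_natCast_mem`), ★★★
`desc_resOfLe_corH1_nsmul_eq_zero` (`p`-torsion).

References: [Kobayashi2003] Def. 1.1; [BDKim2009] pp. 182, 185; [GreenbergVatsal2000] §2 pp. 16–17; [SerreGaloisCohomology1997] I §2.4, I §2.6 (b), II §1.1.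
-/

set_option autoImplicit false
set_option linter.dupNamespace false -- D-0017: single-problem summit, the namespace repeats the problem name by design
noncomputable section

open scoped Classical

namespace Summit.BirchSwinnertonDyer.BirchSwinnertonDyer.Theorems.SmallImageCharSignedSelmer

open NumberField IsDedekindDomain Field Literature.NumberTheory.EllipticCurves Literature.NumberTheory.GaloisRepresentations
  Literature.NumberTheory.EllipticCurves.GreenbergSelmer Literature.NumberTheory.EllipticCurves.GreenbergVatsal2000
  Summit.BirchSwinnertonDyer.Rank1Residual.Additive.LocalTransport Summit.BirchSwinnertonDyer.Rank1Residual.Additive.BaseChange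
  Literature.NumberTheory.EllipticCurves.AcSigned WeierstrassCurve Rat.HeightOneSpectrum

section Desc

variable (K : Type) [Field K] [NumberField K] (hK2 : Module.finrank ℚ K = 2) {p : ℕ} [hp : Fact p.Prime] (hp2 : p ≠ 2)
  (κ : ZpExtension ℚ p) (hκ : κ.IsCyclotomic) (v₀ : HeightOneSpectrum (𝓞 ℚ)) (hv₀ : ((p : ℕ) : 𝓞 ℚ) ∈ v₀.asIdeal)
  (w : HeightOneSpectrum (𝓞 K)) [w.asIdeal.LiesOver v₀.asIdeal]
  (ι : AlgebraicClosure ℚ →ₐ[ℚ] AlgebraicClosure (v₀.adicCompletion ℚ))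
  (ι₂ : AlgebraicClosure (v₀.adicCompletion ℚ) ≃+* AlgebraicClosure (w.adicCompletion K))
  (hcompat : ∀ z : AlgebraicClosure ℚ, closureEmb (K := K) (w.adicCompletion K) (closureEmb (K := ℚ) K z) = ι₂ (ι z))
  (hι₂ : ∀ y : v₀.adicCompletion ℚ, ι₂ (algebraMap (v₀.adicCompletion ℚ) (AlgebraicClosure (v₀.adicCompletion ℚ)) y) =
    algebraMap (w.adicCompletion K) (AlgebraicClosure (w.adicCompletion K)) (adicCompletionMap (K := ℚ) K v₀ w y))
  (hfixU : ∀ h : absoluteGaloisGroup (v₀.adicCompletion ℚ), resGalOfEmb ι h ∈ galRange (K := ℚ) K → ∀ y : w.adicCompletion K,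
    (show AlgebraicClosure (v₀.adicCompletion ℚ) ≃ₐ[v₀.adicCompletion ℚ] AlgebraicClosure (v₀.adicCompletion ℚ) from h)
        (ι₂.symm (algebraMap (w.adicCompletion K) (AlgebraicClosure (w.adicCompletion K)) y)) =
      ι₂.symm (algebraMap (w.adicCompletion K) (AlgebraicClosure (w.adicCompletion K)) y))
  (W : WeierstrassCurve ℚ) [W.IsElliptic] (ε : ℤˣ) (n : ℕ) [((galRange (K := ℚ) K).subgroupOf (κ.layerSubgroup n)).Normal]
  [((κ.restrictOfFinrankEqTwo hp2 K hK2).layerSubgroup n).Normal]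
  (𝔪 : Ideal (𝓞 K)) (hbad : ∀ (ℓ : ℕ) [Fact ℓ.Prime], ℓ ∣ (NumberField.discr K).natAbs * Ideal.absNorm 𝔪 → ¬ W.HasGoodReductionAtPrime ℓ)
  (S₀ : Finset (HeightOneSpectrum (𝓞 ℚ))) (hS₀bad : ∀ v : HeightOneSpectrum (𝓞 ℚ), ¬ W.HasGoodReductionAt v → v ∈ S₀)

include hκ hv₀ hcompat hι₂ hfixU hbad hS₀bad in
/-- ★★★ **Block DESC, composite — membership.** Under the data of `resOfLe_corH1_mem_condAbove_sgn` (the inert local square, a transversal `c`, the group iso `e`)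
and the stub's `hbad`/`hS₀bad`: for `y ∈ H¹(Γ_{K_n}, W_K[p^∞])` killed by `p`, in Kobayashi's condition `E^ε(K_n·K_w)` at `closureEmb K_w`, and unramified outside
`S₀K ∪ {p}` for all `Γ_K`-conjugates, the class `res_{ℚ_∞} cor (e^* subgroupH1Iso (res_= y))` lies in `AcSigned.selmer W p κ ↑S₀ (fun _ ↦ .sgn ε)`.
[cite: Kobayashi2003, Def. 1.1] [cite: BDKim2009, pp. 182, 185] [cite: GreenbergVatsal2000, §2 pp. 16–17] -/
theorem desc_resOfLe_corH1_mem_acSignedSelmer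
    (e : ((galRange (K := ℚ) K).subgroupOf (κ.layerSubgroup n)) →ₜ* (κ.layerSubgroup n ⊓ galRange (K := ℚ) K : Subgroup (absoluteGaloisGroup ℚ)))
    (he : ∀ x : (galRange (K := ℚ) K).subgroupOf (κ.layerSubgroup n),
      ((e x : (κ.layerSubgroup n ⊓ galRange (K := ℚ) K : Subgroup (absoluteGaloisGroup ℚ))) : absoluteGaloisGroup ℚ) =
        ((x : κ.layerSubgroup n) : absoluteGaloisGroup ℚ))
    {c : absoluteGaloisGroup (v₀.adicCompletion ℚ)} (hc : c ∈ localSubgroupOfEmb (κ.layerSubgroup n) ι) (hcU : resGalOfEmb ι c ∉ galRange (K := ℚ) K)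
    (hN : IsOpen (((galRange (K := ℚ) K).subgroupOf (κ.layerSubgroup n) : Subgroup (κ.layerSubgroup n)) : Set (κ.layerSubgroup n)))
    (hM : ∀ m : W.geomPrimaryTorsion p, Continuous fun g : κ.layerSubgroup n ↦ g • m)
    (hopen : IsOpen ((κ.layerSubgroup n ⊓ galRange (K := ℚ) K : Subgroup (absoluteGaloisGroup ℚ)) : Set (absoluteGaloisGroup ℚ)))
    (y : (W.baseChange K).subgroupH1 p ((κ.restrictOfFinrankEqTwo hp2 K hK2).layerSubgroup n)) (hyp : p • y = 0)
    (hy : y ∈ Kobayashi2003.localKummerOverOfEmb (W.baseChange K) p ((κ.restrictOfFinrankEqTwo hp2 K hK2).layerSubgroup n)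
      (closureEmb (K := K) (w.adicCompletion K))
      (Kobayashi2003.signedLocalPointsOfEmb (κ.restrictOfFinrankEqTwo hp2 K hK2) (closureEmb (K := K) (w.adicCompletion K)) (W.baseChange K) ε n))
    (hyunr : y ∈ unramifiedOutside ((κ.restrictOfFinrankEqTwo hp2 K hK2).layerSubgroup n) ((W.baseChange K).geomPrimaryTorsion p) p
      {w' : HeightOneSpectrum (𝓞 K) | ∃ v ∈ S₀, ((natGenerator v : ℕ) : 𝓞 K) ∈ w'.asIdeal}) :
    W.resOfLe p (κ.kerSubgroup_le_layerSubgroup n)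
        (corH1 hN hM (xor_mem_subgroupOf_of_index_two (κ.layerSubgroup n) (galRange (K := ℚ) K) ι (index_galRange_eq_two K hK2) hc hcU)
          (resH1Hom e (AddMonoidHom.id (W.geomPrimaryTorsion p))
            (smul_eq_smul_of_coe_eq W p (κ.layerSubgroup n) (galRange (K := ℚ) K) e he)
            (subgroupH1Iso K W p (inf_le_right : κ.layerSubgroup n ⊓ galRange (K := ℚ) K ≤ galRange (K := ℚ) K)
              ((W.baseChange K).resOfLe p (le_of_eq (comapResGal_layerSubgroup_inf_galRange hp2 κ K hK2 n)) y)))) ∈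
      selmer W p κ (S₀ : Set (HeightOneSpectrum (𝓞 ℚ))) (fun _ ↦ PCond.sgn ε) := by
  -- the transported `ℚ`-side class `x` and the corestricted class `η`
  set x := subgroupH1Iso K W p (inf_le_right : κ.layerSubgroup n ⊓ galRange (K := ℚ) K ≤ galRange (K := ℚ) K)
    ((W.baseChange K).resOfLe p (le_of_eq (comapResGal_layerSubgroup_inf_galRange hp2 κ K hK2 n)) y) with hxdef
  refine resOfLe_mem_acSignedSelmer_of_layer_of_condAbove κ hp2 hκ (S₀ : Set (HeightOneSpectrum (𝓞 ℚ))) ε _ ?_ ?_ ?_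
  · -- `p`-torsion: every map is additive
    rw [← map_nsmul, ← map_nsmul, hxdef, ← map_nsmul, ← map_nsmul, hyp, map_zero, map_zero, map_zero, map_zero]
  · -- away from `p`: -w3 g18's end-to-end DESC-away (p768350: subgroupH1Iso transport + (d2) p768106 + g17's p767858)
    exact corH1_subgroupH1Iso_mem_unramifiedOutside K hK2 hp2 κ W n 𝔪 hbad S₀ hS₀bad e he _ hN hM y hyunr
  · -- at `p`: g17's end-to-end theorem at the unique place `v₀ ∋ p`
    intro v hv
    obtain rfl := Literature.NumberTheory.Automorphic.heightOneSpectrum_rat_eq_of_natCast_mem hp.out hv hv₀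
    exact resOfLe_corH1_mem_condAbove_sgn K hK2 hp2 κ hκ v hv w ι ι₂ hcompat hι₂ hfixU W ε n e he hc hcU hN hM hopen y hy

include hκ hv₀ hcompat hι₂ hfixU hbad hS₀bad in
/-- ★★★ **Block DESC, composite — the element of the INJ_top target.** Same data; the class `res_{ℚ_∞} cor (e^* subgroupH1Iso (res_= y))`, bundled as an element of
`AcSigned.selmer W p κ ↑S₀ (fun _ ↦ .sgn ε)`, is killed by `p` — i.e. lies in `{x | p • x = 0}`, the target of `charRoad_injTop`. [cite: BDKim2009, pp. 182, 185] -/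
theorem desc_resOfLe_corH1_nsmul_eq_zero
    (e : ((galRange (K := ℚ) K).subgroupOf (κ.layerSubgroup n)) →ₜ* (κ.layerSubgroup n ⊓ galRange (K := ℚ) K : Subgroup (absoluteGaloisGroup ℚ)))
    (he : ∀ x : (galRange (K := ℚ) K).subgroupOf (κ.layerSubgroup n),
      ((e x : (κ.layerSubgroup n ⊓ galRange (K := ℚ) K : Subgroup (absoluteGaloisGroup ℚ))) : absoluteGaloisGroup ℚ) =
        ((x : κ.layerSubgroup n) : absoluteGaloisGroup ℚ))
    {c : absoluteGaloisGroup (v₀.adicCompletion ℚ)} (hc : c ∈ localSubgroupOfEmb (κ.layerSubgroup n) ι) (hcU : resGalOfEmb ι c ∉ galRange (K := ℚ) K)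
    (hN : IsOpen (((galRange (K := ℚ) K).subgroupOf (κ.layerSubgroup n) : Subgroup (κ.layerSubgroup n)) : Set (κ.layerSubgroup n)))
    (hM : ∀ m : W.geomPrimaryTorsion p, Continuous fun g : κ.layerSubgroup n ↦ g • m)
    (hopen : IsOpen ((κ.layerSubgroup n ⊓ galRange (K := ℚ) K : Subgroup (absoluteGaloisGroup ℚ)) : Set (absoluteGaloisGroup ℚ)))
    (y : (W.baseChange K).subgroupH1 p ((κ.restrictOfFinrankEqTwo hp2 K hK2).layerSubgroup n)) (hyp : p • y = 0)
    (hy : y ∈ Kobayashi2003.localKummerOverOfEmb (W.baseChange K) p ((κ.restrictOfFinrankEqTwo hp2 K hK2).layerSubgroup n)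
      (closureEmb (K := K) (w.adicCompletion K))
      (Kobayashi2003.signedLocalPointsOfEmb (κ.restrictOfFinrankEqTwo hp2 K hK2) (closureEmb (K := K) (w.adicCompletion K)) (W.baseChange K) ε n))
    (hyunr : y ∈ unramifiedOutside ((κ.restrictOfFinrankEqTwo hp2 K hK2).layerSubgroup n) ((W.baseChange K).geomPrimaryTorsion p) p
      {w' : HeightOneSpectrum (𝓞 K) | ∃ v ∈ S₀, ((natGenerator v : ℕ) : 𝓞 K) ∈ w'.asIdeal}) :
    (⟨W.resOfLe p (κ.kerSubgroup_le_layerSubgroup n)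
        (corH1 hN hM (xor_mem_subgroupOf_of_index_two (κ.layerSubgroup n) (galRange (K := ℚ) K) ι (index_galRange_eq_two K hK2) hc hcU)
          (resH1Hom e (AddMonoidHom.id (W.geomPrimaryTorsion p))
            (smul_eq_smul_of_coe_eq W p (κ.layerSubgroup n) (galRange (K := ℚ) K) e he)
            (subgroupH1Iso K W p (inf_le_right : κ.layerSubgroup n ⊓ galRange (K := ℚ) K ≤ galRange (K := ℚ) K)
              ((W.baseChange K).resOfLe p (le_of_eq (comapResGal_layerSubgroup_inf_galRange hp2 κ K hK2 n)) y)))),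
      desc_resOfLe_corH1_mem_acSignedSelmer K hK2 hp2 κ hκ v₀ hv₀ w ι ι₂ hcompat hι₂ hfixU W ε n 𝔪 hbad S₀ hS₀bad e he hc hcU hN hM hopen y hyp hy hyunr⟩ :
        selmer W p κ (S₀ : Set (HeightOneSpectrum (𝓞 ℚ))) (fun _ ↦ PCond.sgn ε)) ∈
      {x : selmer W p κ (S₀ : Set (HeightOneSpectrum (𝓞 ℚ))) (fun _ ↦ PCond.sgn ε) | p • x = 0} := by
  rw [Set.mem_setOf_eq]
  apply Subtype.ext
  rw [AddSubgroupClass.coe_nsmul]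
  change p • W.resOfLe p (κ.kerSubgroup_le_layerSubgroup n) _ = 0
  rw [← map_nsmul, ← map_nsmul, ← map_nsmul, ← map_nsmul, ← map_nsmul, hyp, map_zero, map_zero, map_zero, map_zero, map_zero]

end Desc

end Summit.BirchSwinnertonDyer.BirchSwinnertonDyer.Theorems.SmallImageCharSignedSelmer

end
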